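import Mathlib
import Summits.Ventures.HodgeRepro2.T5SmoothIsotypic
import Summits.Ventures.HodgeRepro2.T5ConductorArithmetic
import Summits.Ventures.HodgeRepro2.T6N5TateTwist
import Summits.Ventures.HodgeRepro2.T6N5Hyp
import Summits.Ventures.HodgeRepro2.T6N5LocalDatum
import Summits.Ventures.HodgeRepro2.T6N5LocalHyp
import Summits.Ventures.HodgeRepro2.T6N5Local
import Summits.Ventures.HodgeRepro2.T6N5LocalWeil
import Summits.Ventures.HodgeRepro2.T6N5LocalCharDatum
import Summits.Ventures.HodgeRepro2.T6N5LocalInertHyp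
import Summits.Ventures.HodgeRepro2.T6N5LocalInert
import Summits.Ventures.HodgeRepro2.T6N5LocalInertToy
import Summits.Ventures.HodgeRepro2.T6N5LocalInertWeil

/-!
# T6N5LocalInertWeilToy — the non-vacuity witness for `T6N5LocalInertWeil` (README §10.5(ii)(c),(d))

An `InertWeilDatum` on which EVERY binder of `N5LocalInertWeil.InertWeilDatum.N5Local_main_inert_weil` holds
jointly — with the theta predicate DEFINED from a carried Weil representation, not assumed: over the conductor-graded
toy `N5LocalInertToy.toy` (`E = ℕ → ℤˣ`, `F_v^× = ⊥`), the compact group `U(V) = E¹ = E/F_v^× = E` written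
additively (`ToyA`), `ofOne` = the identification of additive characters of `E` with characters `E →* ℂˣ`
(`toyOfOne`, with inverse `toyToAddChar`), and for each sign `s` the Weil representation of the line `V_s` modelled
as the direct sum of the characters that the ε-dichotomy predicts for `V_s`: `Wsp s = Good s →₀ ℂ` with the diagonal
action `(g · v)(ξ) = ξ(g) v(ξ)`, where `Good s` = the conjugate-orthogonal `ξ` with `ε_v(χ_W⁻¹·ξ) = s·ϵ_δ(W)`.
Then: the `α`-isotypic component is non-zero iff `α ∈ Good s` (`thetaOf_iff`), so the Epsilon Dichotomy display
holds for the DEFINED theta (`toyWeil_h35`); the representation is smooth because every character of the exponent-2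
group `E` has a kernel of index `≤ 2` and a finitely supported vector is fixed by the intersection of the kernels of
its support (`toyWeil_smooth`); both spaces are non-zero because both signs occur (`toy_hA1`). `toyInertWeil_solution`
applies `N5Local_main_inert_weil` to it.
README §8(d): uses an L-value-free non-vanishing device: NO.
-/

namespace Summit.Ventures.HodgeRepro2.T6.N5LocalInertWeilToy

open Summit.Ventures.HodgeRepro2.T6.N5LocalDatum Summit.Ventures.HodgeRepro2.T6.N5LocalWeil
  Summit.Ventures.HodgeRepro2.T6.N5LocalCharDatum Summit.Ventures.HodgeRepro2.T6.N5LocalCharDatum.CharDatum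
  Summit.Ventures.HodgeRepro2.T6.N5LocalInertDatum Summit.Ventures.HodgeRepro2.T6.N5Local
  Summit.Ventures.HodgeRepro2.T6.N5LocalInert Summit.Ventures.HodgeRepro2.T6.N5LocalInertToy
  Summit.Ventures.HodgeRepro2.T6.N5LocalInertWeil Summit.Ventures.HodgeRepro2.T6.Hyp
  Summit.Ventures.HodgeRepro2.T5SmoothIsotypic

noncomputable section

/-- `A = U(V) = E¹`: the toy group `E` written additively (`F_v^× = ⊥`, so `E¹ = E/F_v^× = E`). -/
abbrev ToyA : Type := Additive ToyE

/-- Evaluation of a character of `E` at an element of `Multiplicative A`, as a complex number. -/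
def evalAt (ξ : ToyE →* ℂˣ) (g : Multiplicative ToyA) : ℂ :=
  ((ξ (Additive.toMul (Multiplicative.toAdd g)) : ℂˣ) : ℂ)

/-- `evalAt` at the identity. -/
theorem evalAt_one (ξ : ToyE →* ℂˣ) : evalAt ξ 1 = 1 := by
  simp [evalAt]

/-- `evalAt` is multiplicative. -/
theorem evalAt_mul (ξ : ToyE →* ℂˣ) (g h : Multiplicative ToyA) :
    evalAt ξ (g * h) = evalAt ξ g * evalAt ξ h := by
  simp [evalAt, toAdd_mul, toMul_add]

/-- `evalAt` at `ofAdd a`: the value of the character at `a` read in `E`. -/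
theorem evalAt_ofAdd (ξ : ToyE →* ℂˣ) (a : ToyA) :
    evalAt ξ (Multiplicative.ofAdd a) = ((ξ (Additive.toMul a) : ℂˣ) : ℂ) := by
  simp [evalAt]

/-- `ofOne`: an additive character of `A = E¹` read as a character `E →* ℂˣ` (here `j = id`, `F_v^× = ⊥`). -/
def toyOfOne (α : AddChar ToyA ℂ) : ToyE →* ℂˣ :=
  α.toMonoidHom.toHomUnits.comp (MulEquiv.multiplicativeAdditive ToyE).symm.toMonoidHom

/-- The value of `toyOfOne α`. -/
theorem toyOfOne_apply (α : AddChar ToyA ℂ) (x : ToyE) :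
    ((toyOfOne α x : ℂˣ) : ℂ) = α (Additive.ofMul x) := by
  simp [toyOfOne, MonoidHom.coe_toHomUnits]

/-- The additive character of `A` attached to a character of `E` (the inverse of `toyOfOne`). -/
def toyToAddChar (ξ : ToyE →* ℂˣ) : AddChar ToyA ℂ where
  toFun a := ((ξ (Additive.toMul a) : ℂˣ) : ℂ)
  map_zero_eq_one' := by simp
  map_add_eq_mul' a b := by simp [toMul_add]

/-- The value of `toyToAddChar ξ`. -/
theorem toyToAddChar_apply (ξ : ToyE →* ℂˣ) (a : ToyA) :
    toyToAddChar ξ a = ((ξ (Additive.toMul a) : ℂˣ) : ℂ) := rfl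

/-- `toyOfOne ∘ toyToAddChar = id`: every character of `E` is an `α_K`. -/
theorem toyOfOne_toyToAddChar (ξ : ToyE →* ℂˣ) : toyOfOne (toyToAddChar ξ) = ξ := by
  refine MonoidHom.ext fun x => Units.ext ?_
  rw [toyOfOne_apply, toyToAddChar_apply, toMul_ofMul]

/-- The characters occurring in the Weil representation of the line `V_s`: the conjugate-orthogonal characters
whose root number `ε_v(χ_W⁻¹·ξ)` equals `s·ϵ_δ(W)` — the right side of the Epsilon Dichotomy for `V_s`. -/
def Good (s : ℤˣ) : Set (ToyE →* ℂˣ) :=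
  {ξ | toy.toLocalSignDatum.IsCO ξ ∧
    toy.toLocalSignDatum.eps (toy.toLocalSignDatum.χW⁻¹ * ξ) = s * toy.toLocalSignDatum.epsdW}

/-- The space of the toy Weil representation of `V_s`: finitely supported functions on `Good s`
(the direct sum of the lines `ℂ·e_ξ`, `ξ ∈ Good s`). -/
abbrev Wsp (s : ℤˣ) : Type := Good s →₀ ℂ

/-- The diagonal action of `g` on `Wsp s`: `(g · v)(ξ) = ξ(g) v(ξ)`. -/
def toyOp (s : ℤˣ) (g : Multiplicative ToyA) : Wsp s →ₗ[ℂ] Wsp s where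
  toFun v := (fun ξ : Good s => evalAt ξ.1 g) • v
  map_add' v w := by
    ext ξ
    simp [mul_add]
  map_smul' c v := by
    ext ξ
    simp [mul_left_comm]

/-- Coordinates of the diagonal action. -/
theorem toyOp_apply (s : ℤˣ) (g : Multiplicative ToyA) (v : Wsp s) (ξ : Good s) :
    toyOp s g v ξ = evalAt ξ.1 g * v ξ := by
  simp [toyOp]

/-- The toy Weil representation of the line `V_s`: the diagonal action on `Good s →₀ ℂ`. -/
def toyRho (s : ℤˣ) : Representation ℂ (Multiplicative ToyA) (Wsp s) where
  toFun := toyOp s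
  map_one' := by
    refine LinearMap.ext fun v => Finsupp.ext fun ξ => ?_
    simp [toyOp_apply, evalAt_one]
  map_mul' g h := by
    refine LinearMap.ext fun v => Finsupp.ext fun ξ => ?_
    simp [toyOp_apply, evalAt_mul, mul_assoc]

/-- `toyRho` acts by `toyOp`. -/
theorem toyRho_apply (s : ℤˣ) (g : Multiplicative ToyA) (v : Wsp s) (ξ : Good s) :
    toyRho s g v ξ = evalAt ξ.1 g * v ξ :=
  toyOp_apply s g v ξ

/-- The toy inert Weil datum: the conductor-graded toy with the carried Weil representations `toyRho`. -/
abbrev toyWeil : InertWeilDatum where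
  D := toy
  A := ToyA
  Wsp := Wsp
  ωWeil := toyRho
  ofOne := toyOfOne

/-- `e_ξ` lies in the `ξ`-isotypic component of the Weil representation of `V_s` (`ξ ∈ Good s`). -/
theorem single_mem_isotypic (s : ℤˣ) (ξ : Good s) :
    Finsupp.single ξ (1 : ℂ) ∈ isotypic (toyRho s) (toyToAddChar ξ.1) := by
  show ∀ a : ToyA, toyRho s (Multiplicative.ofAdd a) (Finsupp.single ξ 1) =
    toyToAddChar ξ.1 a • Finsupp.single ξ 1
  intro a
  classical
  ext ζ
  rw [toyRho_apply, Finsupp.smul_apply, evalAt_ofAdd, toyToAddChar_apply, smul_eq_mul, Finsupp.single_apply]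
  split_ifs with h
  · subst h
    rfl
  · simp

/-- A non-zero vector of the `α`-isotypic component forces `α_K ∈ Good s`: its support contains some `ξ`, and
the isotypic equation in the coordinate `ξ` gives `ξ = α_K`. -/
theorem toyOfOne_mem_good_of_mem_isotypic {s : ℤˣ} {α : AddChar ToyA ℂ} {v : Wsp s}
    (hv : v ∈ isotypic (toyRho s) α) (hv0 : v ≠ 0) : toyOfOne α ∈ Good s := by
  have hv' : ∀ a : ToyA, toyRho s (Multiplicative.ofAdd a) v = α a • v := hv
  obtain ⟨ξ, hξ⟩ := Finsupp.support_nonempty_iff.mpr hv0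
  have hξ0 : v ξ ≠ 0 := Finsupp.mem_support_iff.mp hξ
  have heq : toyOfOne α = ξ.1 := by
    refine MonoidHom.ext fun x => Units.ext ?_
    have h := congrArg (fun w : Wsp s => w ξ) (hv' (Additive.ofMul x))
    simp only [toyRho_apply, Finsupp.smul_apply, evalAt_ofAdd, toMul_ofMul, smul_eq_mul] at h
    rw [toyOfOne_apply]
    exact (mul_right_cancel₀ hξ0 h).symm
  rw [heq]
  exact ξ.2

/-- The DEFINED theta predicate of the toy is membership in `Good s`: «`Θ_{V_s}(α ∘ i′_V) ≠ 0` iff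
`ε_v(χ_W⁻¹·α_K) = s·ϵ_δ(W)`» — the content of the Epsilon Dichotomy on the toy. -/
theorem thetaOf_iff (s : ℤˣ) (ξ : ToyE →* ℂˣ) : toyWeil.toWeil.thetaOf s ξ ↔ ξ ∈ Good s := by
  constructor
  · rintro ⟨α, rfl, hne⟩
    obtain ⟨v, hv, hv0⟩ := (Submodule.ne_bot_iff _).mp hne
    exact toyOfOne_mem_good_of_mem_isotypic hv hv0
  · intro h
    refine ⟨toyToAddChar ξ, toyOfOne_toyToAddChar ξ, ?_⟩
    rw [Submodule.ne_bot_iff]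
    exact ⟨Finsupp.single ⟨ξ, h⟩ 1, single_mem_isotypic s ⟨ξ, h⟩, Finsupp.single_ne_zero.mpr one_ne_zero⟩

/-- The Epsilon Dichotomy display holds on the toy Weil datum, for the theta predicate DEFINED from the carried
Weil representation. -/
theorem toyWeil_h35 : BFGYYZ2025_Thm3_5 toyWeil.toWeil.toLocalSignDatum := by
  intro s α hα
  show toyWeil.toWeil.thetaOf s α ↔ _
  rw [thetaOf_iff]
  exact ⟨fun h => h.2, fun h => ⟨hα, h⟩⟩

/-- Every element of the toy group `E` has order `≤ 2`. -/
theorem toyE_mul_self (x : ToyE) : x * x = 1 := by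
  funext i
  exact Int.units_mul_self (x i)

/-- Every character of `E` takes the values `±1` only. -/
theorem val_mul_self (ξ : ToyE →* ℂˣ) (x : ToyE) : ξ x * ξ x = 1 := by
  rw [← map_mul, toyE_mul_self, map_one]

/-- The range of a character of `E` is finite (`⊆ {1, −1}`). -/
theorem range_finite (ξ : ToyE →* ℂˣ) : Finite ξ.range := by
  have hsub : (ξ.range : Set ℂˣ) ⊆ {1, -1} := by
    rintro y ⟨x, rfl⟩
    have h := val_mul_self ξ x
    have h' : ((ξ x : ℂˣ) : ℂ) * ((ξ x : ℂˣ) : ℂ) = 1 := by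
      rw [← Units.val_mul, h, Units.val_one]
    simp only [Set.mem_insert_iff, Set.mem_singleton_iff]
    rcases mul_self_eq_one_iff.mp h' with h1 | h1
    · exact Or.inl (Units.ext h1)
    · exact Or.inr (Units.ext (by rw [h1]; rfl))
  exact ((Set.toFinite _).subset hsub).to_subtype

/-- The kernel of a character of `E`, as an additive subgroup of `A`, has finite index. -/
theorem kerA_finiteIndex (ξ : ToyE →* ℂˣ) : (Subgroup.toAddSubgroup ξ.ker).FiniteIndex := by
  haveI := range_finite ξ
  have h : ξ.ker.FiniteIndex := Subgroup.finiteIndex_ker ξ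
  refine AddSubgroup.finiteIndex_iff.mpr ?_
  rw [Subgroup.index_toAddSubgroup]
  exact Subgroup.finiteIndex_iff.mp h

/-- The stabiliser of a vector: the intersection of the kernels of the characters in its (finite) support. -/
def stab (s : ℤˣ) (v : Wsp s) : AddSubgroup ToyA :=
  ⨅ ξ : v.support, Subgroup.toAddSubgroup (ξ.1.1).ker

/-- The stabiliser has finite index (a finite intersection of subgroups of index `≤ 2`). -/
theorem stab_finiteIndex (s : ℤˣ) (v : Wsp s) : (stab s v).FiniteIndex :=
  AddSubgroup.finiteIndex_iInf fun ξ => kerA_finiteIndex ξ.1.1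

/-- The vector is fixed by its stabiliser. -/
theorem mem_fixedBy_stab (s : ℤˣ) (v : Wsp s) : v ∈ fixedBy (toyRho s) (stab s v) := by
  show ∀ k ∈ stab s v, toyRho s (Multiplicative.ofAdd k) v = v
  intro k hk
  ext ξ
  rw [toyRho_apply, evalAt_ofAdd]
  by_cases hξ : ξ ∈ v.support
  · have hker : Additive.toMul k ∈ (ξ.1).ker := AddSubgroup.mem_iInf.mp hk ⟨ξ, hξ⟩
    rw [MonoidHom.mem_ker] at hker
    rw [hker, Units.val_one, one_mul]
  · rw [Finsupp.notMem_support_iff.mp hξ, mul_zero]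

/-- The toy Weil representations are smooth: every vector is fixed by a subgroup of finite index. -/
theorem toyWeil_smooth (s : ℤˣ) : toyWeil.toWeil.IsSmoothCompact s := by
  intro v
  haveI := stab_finiteIndex s v
  haveI : Finite (ToyA ⧸ stab s v) := AddSubgroup.finite_quotient_of_finiteIndex
  exact ⟨stab s v, ⟨Fintype.ofFinite _⟩, mem_fixedBy_stab s v⟩

/-- Both signs occur: `Good s` is non-empty for every `s` (`toy_hA1` + `toy_h35`). -/
theorem good_nonempty (s : ℤˣ) : ∃ ξ, ξ ∈ Good s := by
  obtain ⟨α, hα, hΘ⟩ := toy_hA1 s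
  exact ⟨α, hα, (toy_h35 s α hα).mp hΘ⟩

/-- The toy Weil representations are non-zero. -/
instance instNontrivialWsp (s : ℤˣ) : Nontrivial (Wsp s) := by
  obtain ⟨ξ, hξ⟩ := good_nonempty s
  exact ⟨⟨Finsupp.single ⟨ξ, hξ⟩ 1, 0, Finsupp.single_ne_zero.mpr one_ne_zero⟩⟩

/-- `j(F_v^×) = 1`: every `α_K` is conjugate-orthogonal on the toy (`F_v^× = ⊥`). -/
theorem toyWeil_hofOne (α : AddChar ToyA ℂ) :
    toyWeil.toWeil.toLocalSignDatum.IsCO (toyWeil.toWeil.ofOne α) :=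
  toy_isCO _

/-- EVERY binder of `N5Local_main_inert_weil` holds on the toy Weil datum — with the theta predicate DEFINED from
the carried Weil representation — and the coupled local system is solved there
(README §10.5(ii)(c),(d) for `T6N5LocalInertWeil`). -/
theorem toyInertWeil_solution :
    ∃ ξ : Fin 4 → toyWeil.toWeil.toLocalSignDatum.Char, LocalSolution toyWeil.toWeil.toLocalSignDatum ξ :=
  toyWeil.N5Local_main_inert_weil toy_GGP toy_tate toy_conventions toyU_antitone (by simp)
    (Subgroup.mem_bot.mpr rfl)
    (by show ((1 : ℂˣ) : ℂ) = (-1 : ℂ) ^ ((1 : ℤ) + 1); norm_num) trivial rfl toy_hμ toy_hβ toyWeil_h35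
    toyWeil_smooth toyWeil_hofOne rfl (mul_one (1 : (⊥ : Subgroup ToyE) →* ℂˣ))
    (toy_isCS 1)

end

end Summit.Ventures.HodgeRepro2.T6.N5LocalInertWeilToy
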